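import Mathlib

/-!
# LangWeilTransfer, support item `TameResolution` (stmt-ValiantsHypothesis-6378) — the inner
# (`T`-)degree of the coefficients of `p ∈ ℤ[T][X']` against the total degree of its flattening

Route `LangWeilTransfer` of `ValiantsHypothesis` (conditional route; honest framing: bookkeeping,
nothing here bears on VP ≠ VNP). Quantitative pass (roadmap note of val-lit-p6 g9, §4 (NQ)→(S)):
`totalDegree_coeff_universalEliminant_le` and `exists_relation_coord` take a bound `d_T` on the
`T`-degrees of the coefficients of the transported equations `S'_k = Γ(S_k)`; the Noether loop
bounds the total degree of the flattening (`≤ d`). Here: coefficient degree ≤ flat degree.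

* `totalDegree_coeff_le_totalDegree_flat` (helpers private: the flat-side statements are public in
  val-width's `LangWeilTransferTameResolutionCoordinateBasis`, landed concurrently).
-/

noncomputable section

open MvPolynomial

-- the summit and the problem share the name `ValiantsHypothesis` (D-0017 single-conjunct layout)
set_option linter.dupNamespace false

namespace Summit.ValiantsHypothesis.ValiantsHypothesis.Theorems.LangWeilTransfer

variable {S₁ S₂ : Type*}

/-- The splitting iso on monomials. -/
private theorem sumAlgEquiv_monomial_aux' {R : Type*} [CommRing R] (m : S₁ ⊕ S₂ →₀ ℕ) (c : R) :
    sumAlgEquiv R S₁ S₂ (monomial m c) =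
      monomial (Finsupp.sumFinsuppAddEquivProdFinsupp m).1 (monomial (Finsupp.sumFinsuppAddEquivProdFinsupp m).2 c) := by
  simp [sumAlgEquiv, MvPolynomial.monomial, AddMonoidAlgebra.curryAlgEquiv_single]

/-- The second component of the splitting of an exponent vector has smaller degree. -/
private theorem degree_snd_split_le (m : S₁ ⊕ S₂ →₀ ℕ) :
    ((Finsupp.sumFinsuppAddEquivProdFinsupp m).2.sum fun _ e => e) ≤ m.sum fun _ e => e := by
  classical
  unfold Finsupp.sum
  have hinj : Function.Injective (Sum.inr : S₂ → S₁ ⊕ S₂) := Sum.inr_injective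
  calc ∑ b ∈ (Finsupp.sumFinsuppAddEquivProdFinsupp m).2.support, (Finsupp.sumFinsuppAddEquivProdFinsupp m).2 b
      = ∑ b ∈ (Finsupp.sumFinsuppAddEquivProdFinsupp m).2.support, m (Sum.inr b) := by
        refine Finset.sum_congr rfl fun b _ => ?_
        rw [Finsupp.snd_sumFinsuppAddEquivProdFinsupp]
    _ = ∑ x ∈ ((Finsupp.sumFinsuppAddEquivProdFinsupp m).2.support).map ⟨Sum.inr, hinj⟩, m x := by
        rw [Finset.sum_map]; rfl
    _ ≤ ∑ x ∈ m.support, m x := by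
        refine Finset.sum_le_sum_of_subset_of_nonneg (fun x hx => ?_) (fun _ _ _ => Nat.zero_le _)
        rw [Finset.mem_map] at hx
        obtain ⟨b, hb, rfl⟩ := hx
        rw [Finsupp.mem_support_iff, Finsupp.snd_sumFinsuppAddEquivProdFinsupp] at hb
        exact Finsupp.mem_support_iff.2 hb

/-- Inner degree ≤ flat degree, flat side. -/
private theorem totalDegree_coeff_sumAlgEquiv_le_aux (f : MvPolynomial (S₁ ⊕ S₂) ℤ) (β : S₁ →₀ ℕ) :
    ((sumAlgEquiv ℤ S₁ S₂ f).coeff β).totalDegree ≤ f.totalDegree := by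
  classical
  set e := (Finsupp.sumFinsuppAddEquivProdFinsupp : (S₁ ⊕ S₂ →₀ ℕ) ≃+ (S₁ →₀ ℕ) × (S₂ →₀ ℕ)) with he
  have hsum : sumAlgEquiv ℤ S₁ S₂ f = ∑ m ∈ f.support, monomial (e m).1 (monomial (e m).2 (f.coeff m)) := by
    conv_lhs => rw [f.as_sum]
    rw [map_sum]
    exact Finset.sum_congr rfl fun m _ => sumAlgEquiv_monomial_aux' m (f.coeff m)
  rw [hsum, coeff_sum]
  simp only [coeff_monomial]
  rw [← Finset.sum_filter]
  refine totalDegree_finsetSum_le fun m hm => ?_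
  rw [Finset.mem_filter] at hm
  refine (totalDegree_monomial_le _ _).trans ?_
  refine le_trans ?_ (le_totalDegree hm.1)
  exact degree_snd_split_le m

/-- **Inner degree ≤ flat degree**, for `p ∈ ℤ[X_{S₂}][X_{S₁}]` and its flattening. -/
theorem totalDegree_coeff_le_totalDegree_flat (p : MvPolynomial S₁ (MvPolynomial S₂ ℤ)) (β : S₁ →₀ ℕ) :
    (p.coeff β).totalDegree ≤ ((sumAlgEquiv ℤ S₁ S₂).symm p).totalDegree := by
  have h := totalDegree_coeff_sumAlgEquiv_le_aux ((sumAlgEquiv ℤ S₁ S₂).symm p) β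
  rwa [AlgEquiv.apply_symm_apply] at h

end Summit.ValiantsHypothesis.ValiantsHypothesis.Theorems.LangWeilTransfer
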